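import Literature.MathematicalPhysics.QuantumManyBody.DiluteBoseGasTrialSums
import Literature.MathematicalPhysics.QuantumManyBody.DiluteBoseGasPotentialBessel
import HarnessLib

/-!
# The BCS trial state: the pair coefficients are real, and the convolution sups `Λ`

Topic `Literature/MathematicalPhysics/QuantumManyBody`, namespace `BoseGas.BCSTrial`; theorem-only, for
the provefact `Literature.MathematicalPhysics.QuantumManyBody.BoseGas.BastiCenatiempoSchlein2021_upperBound`.

* `potFT_even`, `potFT_eq_re` — for a radial potential `W_L(-k) = W_L(k)`, so `W_L` is real;
* `sum_W_shift_sq_le` — Bessel transported to the box: `∑_p |W(k - e p)|² ≤ L³∫v²`;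
* `sum_abs_W_div_nsq_le` — the convolution sup against `|n|⁻²` beyond `P_L`,
  `sup_k ∑_{|n|²>ρ^{-7/5}} |W(k - e p)|/|n|² ≤ 96W(0)ρ^{-11/10} + (192√3)^{1/2}(∫v²)^{1/2} L`
  (split at `|n| = L`: bounded coefficients below, Cauchy–Schwarz with Bessel above) — the
  substitute for (intVeta) of [BastiCenatiempoSchlein2021].

## References

* [BastiCenatiempoSchlein2021] G. Basti, S. Cenatiempo, B. Schlein, Forum Math. Sigma 9 (2021) e74,
  arXiv:2101.06222: §2 (intVeta), §5.
-/

noncomputable section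

namespace Literature.MathematicalPhysics.QuantumManyBody.BoseGas

open MeasureTheory Complex Finset
open scoped ENNReal BigOperators ComplexConjugate

/-! ### `W_L` is real and even for a radial potential -/

/-- **`W_L(-k) = W_L(k)`** for a radial potential (substitute `z ↦ -z`). [folklore] -/
theorem potFT_even (v : ℝ → ℝ≥0∞) (L : ℝ) (k : Momentum) : potFT v L (-k) = potFT v L k := by
  unfold potFT
  rw [← integral_neg_eq_self (fun z : Space => ((v ‖z‖).toReal : ℂ) * cellWave L k z)]
  refine integral_congr_ae (Filter.Eventually.of_forall fun z => ?_)
  simp only [norm_neg]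
  congr 1
  rw [cellWave_apply, cellWave_apply]
  congr 1
  simp only [Pi.neg_apply, Int.cast_neg, PiLp.neg_apply]
  push_cast
  ring_nf

/-- **`W_L(k)` is real**: `W_L(k) = Re W_L(k)`. [folklore] -/
theorem potFT_eq_re (v : ℝ → ℝ≥0∞) (L : ℝ) (k : Momentum) : potFT v L k = (((potFT v L k).re : ℝ) : ℂ) := by
  have h : conj (potFT v L k) = potFT v L k := by rw [← potFT_neg, potFT_even]
  exact (Complex.conj_eq_iff_re.1 h).symm

namespace BCSTrial

variable {v : ℝ → ℝ≥0∞} {ρ : ℝ}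

/-- `(W v ρ k : ℂ) = potFT v L k`. [folklore] -/
theorem ofReal_W (v : ℝ → ℝ≥0∞) (ρ : ℝ) (k : Momentum) : ((W v ρ k : ℝ) : ℂ) = potFT v (boxSide ρ) k := by
  unfold W; rw [← potFT_eq_re]

/-! ### Bessel on the box -/

/-- **`∑_p |W(k - e p)|² ≤ L³ ∫ v²`** (the shift `p ↦ k - e p` is injective; Bessel for `W_L`).
[cite: BastiCenatiempoSchlein2021, §2 (intVeta) (the `ℓ²` substitute)] -/
theorem sum_W_shift_sq_le (hv : Measurable v) {R₀ : ℝ} (hsupp : ∀ r, R₀ < r → v r = 0) (hρ : 0 < ρ)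
    (hR : 2 * R₀ < boxSide ρ) (h2 : (∫⁻ z : Space, v ‖z‖ ^ 2) ≠ ⊤) (k : Momentum) :
    ∑ p : ModeBox (boxSize ρ), W v ρ (k - e _ p) ^ 2 ≤ boxSide ρ ^ 3 * ∫ z : Space, (v ‖z‖).toReal ^ 2 := by
  classical
  have hL := boxSide_pos hρ
  have hinj : Function.Injective fun p : ModeBox (boxSize ρ) => k - e _ p := fun p q h => e_injective _ (by
    simpa using h)
  calc ∑ p : ModeBox (boxSize ρ), W v ρ (k - e _ p) ^ 2 ≤ ∑ p : ModeBox (boxSize ρ), ‖potFT v (boxSide ρ) (k - e _ p)‖ ^ 2 := by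
        refine Finset.sum_le_sum fun p _ => ?_
        unfold W
        rw [← sq_abs]
        exact pow_le_pow_left₀ (abs_nonneg _) (Complex.abs_re_le_norm _) 2
    _ = ∑ m ∈ Finset.univ.image (fun p : ModeBox (boxSize ρ) => k - e _ p), ‖potFT v (boxSide ρ) m‖ ^ 2 := by
        rw [Finset.sum_image (hinj.injOn)]
    _ ≤ _ := sum_norm_potFT_sq_le hL hv hsupp hR h2 _

/-! ### `∑_{0 < |n|² ≤ A} |n|⁻²` -/

/-- **`∑_{p : 0 < |n|² ≤ A} |n|⁻² ≤ 96√A`.** [folklore] -/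
theorem sum_inv_nsq_le {M : ℕ} (s : Finset (ModeBox M)) {A : ℝ}
    (hs : ∀ p ∈ s, 0 < nsq (e M p) ∧ nsq (e M p) ≤ A) :
    ∑ p ∈ s, (nsq (e M p))⁻¹ ≤ 96 * Real.sqrt A := by
  set R := ⌊Real.sqrt A⌋₊ with hR
  calc ∑ p ∈ s, (nsq (e M p))⁻¹
      ≤ ∑ p ∈ s, ((((univ.sup fun j => (e M p j).natAbs : ℕ)) : ℝ) ^ 2)⁻¹ := by
        refine Finset.sum_le_sum fun p hp => ?_
        have h1 := one_le_supNorm (hs p hp).1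
        have h1' : (1 : ℝ) ≤ (((univ.sup fun j => (e M p j).natAbs : ℕ)) : ℝ) := by exact_mod_cast h1
        exact inv_anti₀ (by positivity) (supNorm_sq_le_nsq' _)
    _ = ∑ n ∈ s.map ⟨e M, e_injective M⟩, ((((univ.sup fun j => (n j).natAbs : ℕ)) : ℝ) ^ 2)⁻¹ :=
        sum_eq_sum_map s (fun n => ((((univ.sup fun j => (n j).natAbs : ℕ)) : ℝ) ^ 2)⁻¹)
    _ = ∑ n ∈ (s.map ⟨e M, e_injective M⟩).filter (fun n => 1 ≤ (univ.sup fun j => (n j).natAbs) ∧ (univ.sup fun j => (n j).natAbs) ≤ R),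
          ((((univ.sup fun j => (n j).natAbs : ℕ)) : ℝ) ^ 2)⁻¹ := by
        rw [Finset.filter_true_of_mem]
        intro n hn
        rw [Finset.mem_map] at hn
        obtain ⟨p, hp, rfl⟩ := hn
        exact ⟨one_le_supNorm (hs p hp).1, supNorm_le_floor_sqrt (hs p hp).2⟩
    _ ≤ 96 * (R : ℝ) := sum_inv_supNorm_sq_le _ R
    _ ≤ 96 * Real.sqrt A := by gcongr; exact Nat.floor_le (Real.sqrt_nonneg _)

/-! ### The convolution sup beyond `P_L` -/

/-- **`∑_{p : |n|² > ρ^{-7/5}} |W(k - e p)|/|n|² ≤ 96W(0)ρ^{-11/10} + (192√3)^{1/2}(∫v²)^{1/2}·L`**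
uniformly in `k`: the bounded coefficients `|W| ≤ W(0)` on `|n|² ≤ L²` and Cauchy–Schwarz with
Bessel on `|n|² > L²`. [cite: BastiCenatiempoSchlein2021, §2 (intVeta)] -/
theorem sum_abs_W_div_nsq_le (hv : Measurable v) {R₀ : ℝ} (hsupp : ∀ r, R₀ < r → v r = 0) (hρ : 0 < ρ)
    (hR : 2 * R₀ < boxSide ρ) (h2 : (∫⁻ z : Space, v ‖z‖ ^ 2) ≠ ⊤) (k : Momentum) :
    ∑ p ∈ Finset.univ.filter (fun p : ModeBox (boxSize ρ) => ρ ^ (-(7 : ℝ) / 5) < nsq (e _ p)),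
        |W v ρ (k - e _ p)| * (nsq (e _ p))⁻¹ ≤
      96 * W v ρ 0 * ρ ^ (-(11 : ℝ) / 10) +
        Real.sqrt (192 * Real.sqrt 3) * Real.sqrt (∫ z : Space, (v ‖z‖).toReal ^ 2) * boxSide ρ := by
  have hL := boxSide_pos hρ
  have hW0 := W_zero_nonneg v ρ
  set s := Finset.univ.filter (fun p : ModeBox (boxSize ρ) => ρ ^ (-(7 : ℝ) / 5) < nsq (e _ p)) with hs
  set B : ℝ := boxSide ρ ^ 2 with hB
  have hB0 : 0 < B := by positivity
  have h75 : 0 < ρ ^ (-(7 : ℝ) / 5) := Real.rpow_pos_of_pos hρ _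
  rw [← Finset.sum_filter_add_sum_filter_not s (fun p => nsq (e _ p) ≤ B)]
  refine add_le_add ?_ ?_
  · -- `|n|² ≤ L²`: `|W| ≤ W(0)` and `∑ |n|⁻² ≤ 96 L`
    calc ∑ p ∈ s.filter (fun p => nsq (e _ p) ≤ B), |W v ρ (k - e _ p)| * (nsq (e _ p))⁻¹
        ≤ ∑ p ∈ s.filter (fun p => nsq (e _ p) ≤ B), W v ρ 0 * (nsq (e _ p))⁻¹ :=
          Finset.sum_le_sum fun p _ => mul_le_mul_of_nonneg_right (abs_W_le v ρ _) (inv_nonneg.2 (nsq_nonneg _))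
      _ = W v ρ 0 * ∑ p ∈ s.filter (fun p => nsq (e _ p) ≤ B), (nsq (e _ p))⁻¹ := by rw [Finset.mul_sum]
      _ ≤ W v ρ 0 * (96 * Real.sqrt B) := by
          refine mul_le_mul_of_nonneg_left (sum_inv_nsq_le _ fun p hp => ?_) hW0
          rw [Finset.mem_filter, hs, Finset.mem_filter] at hp
          exact ⟨h75.trans hp.1.2, hp.2⟩
      _ = 96 * W v ρ 0 * ρ ^ (-(11 : ℝ) / 10) := by
          rw [hB, Real.sqrt_sq hL.le]; unfold boxSide; ring
  · -- `|n|² > L²`: Cauchy–Schwarz and Bessel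
    have hcs := Real.sum_mul_le_sqrt_mul_sqrt (s.filter (fun p => ¬ nsq (e _ p) ≤ B))
      (fun p => |W v ρ (k - e _ p)|) (fun p => (nsq (e _ p))⁻¹)
    refine hcs.trans ?_
    have h1 : ∑ p ∈ s.filter (fun p => ¬ nsq (e _ p) ≤ B), |W v ρ (k - e _ p)| ^ 2 ≤
        boxSide ρ ^ 3 * ∫ z : Space, (v ‖z‖).toReal ^ 2 := by
      calc _ ≤ ∑ p : ModeBox (boxSize ρ), |W v ρ (k - e _ p)| ^ 2 :=
            Finset.sum_le_univ_sum_of_nonneg fun p => sq_nonneg _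
        _ = ∑ p : ModeBox (boxSize ρ), W v ρ (k - e _ p) ^ 2 := Finset.sum_congr rfl fun p _ => sq_abs _
        _ ≤ _ := sum_W_shift_sq_le hv hsupp hρ hR h2 k
    have h2' : ∑ p ∈ s.filter (fun p => ¬ nsq (e _ p) ≤ B), ((nsq (e _ p))⁻¹) ^ 2 ≤ 192 * Real.sqrt 3 / Real.sqrt B := by
      calc _ = ∑ p ∈ s.filter (fun p => ¬ nsq (e _ p) ≤ B), (nsq (e _ p) ^ 2)⁻¹ :=
            Finset.sum_congr rfl fun p _ => by rw [inv_pow]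
        _ ≤ _ := sum_inv_nsq_sq_le _ hB0 fun p hp => lt_of_not_ge (Finset.mem_filter.1 hp).2
    have hI0 : 0 ≤ ∫ z : Space, (v ‖z‖).toReal ^ 2 := integral_nonneg fun z => sq_nonneg _
    calc Real.sqrt (∑ p ∈ s.filter (fun p => ¬ nsq (e _ p) ≤ B), |W v ρ (k - e _ p)| ^ 2) *
          Real.sqrt (∑ p ∈ s.filter (fun p => ¬ nsq (e _ p) ≤ B), ((nsq (e _ p))⁻¹) ^ 2)
        ≤ Real.sqrt (boxSide ρ ^ 3 * ∫ z : Space, (v ‖z‖).toReal ^ 2) * Real.sqrt (192 * Real.sqrt 3 / Real.sqrt B) :=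
          mul_le_mul (Real.sqrt_le_sqrt h1) (Real.sqrt_le_sqrt h2') (Real.sqrt_nonneg _) (Real.sqrt_nonneg _)
      _ = Real.sqrt (192 * Real.sqrt 3) * Real.sqrt (∫ z : Space, (v ‖z‖).toReal ^ 2) * boxSide ρ := by
          rw [hB, Real.sqrt_sq hL.le]
          -- `√(L³ I) √(c/L) = √c √I L`
          have hsq : Real.sqrt (boxSide ρ ^ 3 * ∫ z : Space, (v ‖z‖).toReal ^ 2) * Real.sqrt (192 * Real.sqrt 3 / boxSide ρ) =
              Real.sqrt ((boxSide ρ ^ 3 * ∫ z : Space, (v ‖z‖).toReal ^ 2) * (192 * Real.sqrt 3 / boxSide ρ)) :=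
            (Real.sqrt_mul (by positivity) _).symm
          rw [hsq, show (boxSide ρ ^ 3 * ∫ z : Space, (v ‖z‖).toReal ^ 2) * (192 * Real.sqrt 3 / boxSide ρ) =
            (192 * Real.sqrt 3) * (∫ z : Space, (v ‖z‖).toReal ^ 2) * boxSide ρ ^ 2 by field_simp,
            Real.sqrt_mul (by positivity), Real.sqrt_mul (by positivity), Real.sqrt_sq hL.le]

/-! ### `∑_{P_L}|γσ|`, `∑_{P_L}|η|` and `Λ` -/

section LowSums

variable (hv : Measurable v) (hint : (∫⁻ x : Space, v ‖x‖) ≠ ⊤) (hρ : 0 < ρ)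
include hv hint hρ

/-- On `P_L`: `|γ_pσ_p| ≤ √(ρW(0))L/(4√2π)·|n|⁻¹` and `|γ_pσ_p| ≤ ρW(0)L²/(8π²)·|n|⁻²`. [cite: BastiCenatiempoSchlein2021, §2] -/
theorem abs_gs_le_of_mem_lowSet {p : ModeBox (boxSize ρ)} (hp : p ∈ lowSet ρ) :
    |Fock.bogGamma (neg _) (halfSpace _) (tAmp v ρ) p * Fock.bogSigma (neg _) (halfSpace _) (tAmp v ρ) p| ≤
        Real.sqrt (ρ * W v ρ 0) * boxSide ρ / (4 * Real.sqrt 2 * Real.pi) * (Real.sqrt (nsq (e _ p)))⁻¹ ∧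
      |Fock.bogGamma (neg _) (halfSpace _) (tAmp v ρ) p * Fock.bogSigma (neg _) (halfSpace _) (tAmp v ρ) p| ≤
        ρ * W v ρ 0 * boxSide ρ ^ 2 / (8 * Real.pi ^ 2) * (nsq (e _ p))⁻¹ := by
  have hW0 := W_zero_nonneg v ρ
  have hL := boxSide_pos hρ
  have hε := eps_pos' hρ (ne_z_of_mem_lowSet hp)
  have hg := gCoupling_nonneg hv hint hρ
  have hgle := gCoupling_le hv hint hρ
  have hn : 0 < nsq (e _ p) := (mem_lowSet.1 hp).1
  obtain ⟨-, h2, h3⟩ := bogSigma_sq_le_of_mem hv hint hρ hp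
  rw [bogGamma_mul_bogSigma_of_mem hv hint hρ hp, abs_div, abs_neg, abs_of_nonneg hg, abs_of_pos (by positivity)]
  constructor
  · -- via `√(g/(8ε))`, as for `σ²`
    have h4 : gCoupling v ρ / (8 * eps ρ p) ≤ ρ * W v ρ 0 * boxSide ρ ^ 2 / (32 * Real.pi ^ 2 * nsq (e _ p)) := by
      rw [eps_eq, div_le_div_iff₀ (by positivity) (by positivity)]
      calc gCoupling v ρ * (32 * Real.pi ^ 2 * nsq (e (boxSize ρ) p))
          = gCoupling v ρ * (8 * (4 * Real.pi ^ 2 * nsq (e (boxSize ρ) p) / boxSide ρ ^ 2)) * boxSide ρ ^ 2 := by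
            field_simp; ring
        _ ≤ ρ * W v ρ 0 * boxSide ρ ^ 2 * (8 * (4 * Real.pi ^ 2 * nsq (e (boxSize ρ) p) / boxSide ρ ^ 2)) := by
            nlinarith [mul_le_mul_of_nonneg_right hgle (show 0 ≤ (8 * (4 * Real.pi ^ 2 * nsq (e (boxSize ρ) p) / boxSide ρ ^ 2)) * boxSide ρ ^ 2 by positivity)]
    have h5 : Real.sqrt (ρ * W v ρ 0 * boxSide ρ ^ 2 / (32 * Real.pi ^ 2 * nsq (e _ p))) =
        Real.sqrt (ρ * W v ρ 0) * boxSide ρ / (4 * Real.sqrt 2 * Real.pi) * (Real.sqrt (nsq (e _ p)))⁻¹ := by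
      rw [Real.sqrt_div' _ (by positivity), Real.sqrt_mul' _ (sq_nonneg _), Real.sqrt_sq hL.le,
        Real.sqrt_mul' _ hn.le, show (32 : ℝ) * Real.pi ^ 2 = (4 * Real.sqrt 2 * Real.pi) ^ 2 by
          rw [mul_pow, mul_pow, Real.sq_sqrt (by norm_num : (0:ℝ) ≤ 2)]; ring, Real.sqrt_sq (by positivity)]
      field_simp
    calc _ ≤ Real.sqrt (gCoupling v ρ / (8 * eps ρ p)) := Real.le_sqrt_of_sq_le h2
      _ ≤ Real.sqrt (ρ * W v ρ 0 * boxSide ρ ^ 2 / (32 * Real.pi ^ 2 * nsq (e _ p))) := Real.sqrt_le_sqrt h4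
      _ = _ := h5
  · -- via `g/(2ε)`
    refine h3.trans ?_
    rw [eps_eq]
    calc gCoupling v ρ / (2 * (4 * Real.pi ^ 2 * nsq (e (boxSize ρ) p) / boxSide ρ ^ 2))
        ≤ ρ * W v ρ 0 / (2 * (4 * Real.pi ^ 2 * nsq (e (boxSize ρ) p) / boxSide ρ ^ 2)) :=
          div_le_div_of_nonneg_right hgle (by positivity)
      _ = _ := by field_simp; ring

/-- **`∑_{P_L}|γσ| ≤ (24/(√2π))√W(0)·ρ^{-9/5} + (12/π²)W(0)·ρ^{-19/10}`** (`‖σ_Lγ_L‖₁`-type sum).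
[cite: BastiCenatiempoSchlein2021, §2 ("`‖σ_Lγ_L‖₁ ≤ CN^{3κ/2…}`")] -/
theorem sum_lowSet_abs_gs_le :
    ∑ p ∈ lowSet ρ, |Fock.bogGamma (neg _) (halfSpace _) (tAmp v ρ) p * Fock.bogSigma (neg _) (halfSpace _) (tAmp v ρ) p| ≤
      24 / (Real.sqrt 2 * Real.pi) * Real.sqrt (W v ρ 0) * ρ ^ (-(9 : ℝ) / 5) +
        12 / Real.pi ^ 2 * W v ρ 0 * ρ ^ (-(19 : ℝ) / 10) := by
  have hL := boxSide_pos hρ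
  have hW0 := W_zero_nonneg v ρ
  set A : ℝ := ρ ^ (-(6 : ℝ) / 5) with hA
  have hA0 : 0 < A := Real.rpow_pos_of_pos hρ _
  rw [← Finset.sum_filter_add_sum_filter_not (lowSet ρ) (fun p => nsq (e _ p) ≤ A)]
  refine add_le_add ?_ ?_
  · calc _ ≤ ∑ p ∈ (lowSet ρ).filter (fun p => nsq (e _ p) ≤ A),
          Real.sqrt (ρ * W v ρ 0) * boxSide ρ / (4 * Real.sqrt 2 * Real.pi) * (Real.sqrt (nsq (e _ p)))⁻¹ :=
          Finset.sum_le_sum fun p hp => (abs_gs_le_of_mem_lowSet hv hint hρ (Finset.mem_filter.1 hp).1).1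
      _ = Real.sqrt (ρ * W v ρ 0) * boxSide ρ / (4 * Real.sqrt 2 * Real.pi) *
          ∑ p ∈ (lowSet ρ).filter (fun p => nsq (e _ p) ≤ A), (Real.sqrt (nsq (e _ p)))⁻¹ := by rw [Finset.mul_sum]
      _ ≤ Real.sqrt (ρ * W v ρ 0) * boxSide ρ / (4 * Real.sqrt 2 * Real.pi) * (96 * A) := by
          refine mul_le_mul_of_nonneg_left (sum_inv_sqrt_nsq_le _ hA0.le fun p hp => ?_) (by positivity)
          rw [Finset.mem_filter] at hp
          exact ⟨(mem_lowSet.1 hp.1).1, hp.2⟩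
      _ = _ := by
          rw [Real.sqrt_mul' _ hW0, ← rpow_combo₁ hρ, hA]
          field_simp
          ring
  · set B : ℝ := ρ ^ (-(7 : ℝ) / 5) with hB
    calc _ ≤ ∑ p ∈ (lowSet ρ).filter (fun p => ¬ nsq (e _ p) ≤ A),
          ρ * W v ρ 0 * boxSide ρ ^ 2 / (8 * Real.pi ^ 2) * (nsq (e _ p))⁻¹ :=
          Finset.sum_le_sum fun p hp => (abs_gs_le_of_mem_lowSet hv hint hρ (Finset.mem_filter.1 hp).1).2
      _ = ρ * W v ρ 0 * boxSide ρ ^ 2 / (8 * Real.pi ^ 2) *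
          ∑ p ∈ (lowSet ρ).filter (fun p => ¬ nsq (e _ p) ≤ A), (nsq (e _ p))⁻¹ := by rw [Finset.mul_sum]
      _ ≤ ρ * W v ρ 0 * boxSide ρ ^ 2 / (8 * Real.pi ^ 2) * (96 * Real.sqrt B) := by
          refine mul_le_mul_of_nonneg_left (sum_inv_nsq_le _ fun p hp => ?_) (by positivity)
          rw [Finset.mem_filter] at hp
          exact mem_lowSet.1 hp.1
      _ = _ := by
          rw [hB, boxSide_sq hρ, Real.sqrt_eq_rpow, ← Real.rpow_mul hρ.le]
          have : ρ * ρ ^ (-(11 : ℝ) / 5) * ρ ^ (-(7 : ℝ) / 5 * (1 / 2)) = ρ ^ (-(19 : ℝ) / 10) := by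
            rw [show (ρ : ℝ) * ρ ^ (-(11 : ℝ) / 5) = ρ ^ (1 : ℝ) * ρ ^ (-(11 : ℝ) / 5) by rw [Real.rpow_one],
              ← Real.rpow_add hρ, ← Real.rpow_add hρ]
            norm_num
          rw [← this]
          field_simp
          ring

/-- **`∑_{P_L}|η| ≤ (12/π²)W(0)·ρ^{-19/10}`.** [cite: BastiCenatiempoSchlein2021, (2.4)] -/
theorem sum_lowSet_abs_eta_le :
    ∑ p ∈ lowSet ρ, |eta v ρ p| ≤ 12 / Real.pi ^ 2 * W v ρ 0 * ρ ^ (-(19 : ℝ) / 10) := by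
  have hL := boxSide_pos hρ
  have hW0 := W_zero_nonneg v ρ
  set B : ℝ := ρ ^ (-(7 : ℝ) / 5) with hB
  calc _ ≤ ∑ p ∈ lowSet ρ, ρ * W v ρ 0 * boxSide ρ ^ 2 / (8 * Real.pi ^ 2) * (nsq (e _ p))⁻¹ := by
        refine Finset.sum_le_sum fun p hp => ?_
        have h := abs_eta_le hv hint hρ (ne_z_of_mem_lowSet hp)
        have hn : 0 < nsq (e _ p) := (mem_lowSet.1 hp).1
        calc |eta v ρ p| ≤ ρ * W v ρ 0 * boxSide ρ ^ 2 / (8 * Real.pi ^ 2 * nsq (e _ p)) := h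
          _ = _ := by field_simp
    _ = ρ * W v ρ 0 * boxSide ρ ^ 2 / (8 * Real.pi ^ 2) * ∑ p ∈ lowSet ρ, (nsq (e _ p))⁻¹ := by rw [Finset.mul_sum]
    _ ≤ ρ * W v ρ 0 * boxSide ρ ^ 2 / (8 * Real.pi ^ 2) * (96 * Real.sqrt B) :=
        mul_le_mul_of_nonneg_left (sum_inv_nsq_le _ fun p hp => mem_lowSet.1 hp) (by positivity)
    _ = _ := by
        rw [hB, boxSide_sq hρ, Real.sqrt_eq_rpow, ← Real.rpow_mul hρ.le]
        have : ρ * ρ ^ (-(11 : ℝ) / 5) * ρ ^ (-(7 : ℝ) / 5 * (1 / 2)) = ρ ^ (-(19 : ℝ) / 10) := by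
          rw [show (ρ : ℝ) * ρ ^ (-(11 : ℝ) / 5) = ρ ^ (1 : ℝ) * ρ ^ (-(11 : ℝ) / 5) by rw [Real.rpow_one],
            ← Real.rpow_add hρ, ← Real.rpow_add hρ]
          norm_num
        rw [← this]
        field_simp
        ring

/-- **The convolution sup `Λ`**: for every `k`,
`∑_p |W(k - e p)||γ_pσ_p| ≤ W(0)·[(24/(√2π))√W(0)ρ^{-9/5} + (12/π²)W(0)ρ^{-19/10}]`
`+ (ρW(0)L²/(6π²))·[96W(0)ρ^{-11/10} + (192√3)^{1/2}(∫v²)^{1/2}L]` (`= O(ρ^{-23/10})`): the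
hypothesis `hΛle` of `norm_G2_sub_const_le`. [cite: BastiCenatiempoSchlein2021, §2 (intVeta), §4 (G₂)] -/
theorem Lambda_le {R₀ : ℝ} (hsupp : ∀ r, R₀ < r → v r = 0) (hR : 2 * R₀ < boxSide ρ)
    (h2 : (∫⁻ z : Space, v ‖z‖ ^ 2) ≠ ⊤) (k : Momentum) :
    ∑ p : ModeBox (boxSize ρ), |W v ρ (k - e _ p)| *
        |Fock.bogGamma (neg _) (halfSpace _) (tAmp v ρ) p * Fock.bogSigma (neg _) (halfSpace _) (tAmp v ρ) p| ≤
      W v ρ 0 * (24 / (Real.sqrt 2 * Real.pi) * Real.sqrt (W v ρ 0) * ρ ^ (-(9 : ℝ) / 5) +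
          12 / Real.pi ^ 2 * W v ρ 0 * ρ ^ (-(19 : ℝ) / 10)) +
        ρ * W v ρ 0 * boxSide ρ ^ 2 / (6 * Real.pi ^ 2) *
          (96 * W v ρ 0 * ρ ^ (-(11 : ℝ) / 10) +
            Real.sqrt (192 * Real.sqrt 3) * Real.sqrt (∫ z : Space, (v ‖z‖).toReal ^ 2) * boxSide ρ) := by
  have hL := boxSide_pos hρ
  have hW0 := W_zero_nonneg v ρ
  rw [← Finset.sum_filter_add_sum_filter_not Finset.univ (fun p => p ∈ lowSet ρ), Finset.filter_mem_eq_inter,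
    Finset.univ_inter]
  refine add_le_add ?_ ?_
  · -- `P_L`: `|W| ≤ W(0)`
    calc ∑ p ∈ lowSet ρ, |W v ρ (k - e _ p)| *
          |Fock.bogGamma (neg _) (halfSpace _) (tAmp v ρ) p * Fock.bogSigma (neg _) (halfSpace _) (tAmp v ρ) p|
        ≤ ∑ p ∈ lowSet ρ, W v ρ 0 *
          |Fock.bogGamma (neg _) (halfSpace _) (tAmp v ρ) p * Fock.bogSigma (neg _) (halfSpace _) (tAmp v ρ) p| :=
          Finset.sum_le_sum fun p _ => mul_le_mul_of_nonneg_right (abs_W_le v ρ _) (abs_nonneg _)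
      _ = W v ρ 0 * ∑ p ∈ lowSet ρ,
          |Fock.bogGamma (neg _) (halfSpace _) (tAmp v ρ) p * Fock.bogSigma (neg _) (halfSpace _) (tAmp v ρ) p| := by
          rw [Finset.mul_sum]
      _ ≤ _ := mul_le_mul_of_nonneg_left (sum_lowSet_abs_gs_le hv hint hρ) hW0
  · -- off `P_L`: `|γσ| ≤ (4/3)|η| ≤ ρW(0)L²/(6π²)|n|⁻²`, the condensate contributes `0`
    have hz : ∑ p ∈ Finset.univ.filter (fun p => p ∉ lowSet ρ), |W v ρ (k - e _ p)| *
          |Fock.bogGamma (neg _) (halfSpace _) (tAmp v ρ) p * Fock.bogSigma (neg _) (halfSpace _) (tAmp v ρ) p| =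
        ∑ p ∈ Finset.univ.filter (fun p : ModeBox (boxSize ρ) => ρ ^ (-(7 : ℝ) / 5) < nsq (e _ p)), |W v ρ (k - e _ p)| *
          |Fock.bogGamma (neg _) (halfSpace _) (tAmp v ρ) p * Fock.bogSigma (neg _) (halfSpace _) (tAmp v ρ) p| := by
      symm
      refine Finset.sum_subset (fun p hp => ?_) (fun p hp hp' => ?_)
      · rw [Finset.mem_filter] at hp ⊢
        exact ⟨Finset.mem_univ _, fun h => not_le.2 hp.2 (mem_lowSet.1 h).2⟩
      · rw [Finset.mem_filter] at hp hp'
        have hpz : p = z _ := by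
          by_contra hne
          have hn1 : 1 ≤ nsq (e _ p) := one_le_nsq (fun h0 => hne ((e_eq_zero_iff _ p).1 h0))
          have : ¬ ρ ^ (-(7 : ℝ) / 5) < nsq (e _ p) := fun h => hp' ⟨Finset.mem_univ _, h⟩
          exact hp.2 (mem_lowSet.2 ⟨by linarith, le_of_not_gt this⟩)
        rw [hpz, Fock.bogSigma_z (fun q hq => neg_not_mem_halfSpace hq) (neg_z _), mul_zero, abs_zero, mul_zero]
    rw [hz]
    have hsub : ∑ p ∈ Finset.univ.filter (fun p : ModeBox (boxSize ρ) => ρ ^ (-(7 : ℝ) / 5) < nsq (e _ p)), |W v ρ (k - e _ p)| *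
          |Fock.bogGamma (neg _) (halfSpace _) (tAmp v ρ) p * Fock.bogSigma (neg _) (halfSpace _) (tAmp v ρ) p| ≤
        ∑ p ∈ Finset.univ.filter (fun p : ModeBox (boxSize ρ) => ρ ^ (-(7 : ℝ) / 5) < nsq (e _ p)),
          ρ * W v ρ 0 * boxSide ρ ^ 2 / (6 * Real.pi ^ 2) * (|W v ρ (k - e _ p)| * (nsq (e _ p))⁻¹) := by
      refine Finset.sum_le_sum fun p hp => ?_
      rw [Finset.mem_filter] at hp
      have h75 : 0 < ρ ^ (-(7 : ℝ) / 5) := Real.rpow_pos_of_pos hρ _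
      have hn : 0 < nsq (e _ p) := h75.trans hp.2
      have hpl : p ∉ lowSet ρ := fun h => not_le.2 hp.2 (mem_lowSet.1 h).2
      have hpz : p ≠ z _ := fun h => by
        have : nsq (e _ p) = 0 := by rw [h, e_z]; simp [nsq]
        linarith
      have h1 := (angles_le_of_not_mem hv hint hρ hpl).2.1
      have h2 := abs_eta_le hv hint hρ hpz
      calc |W v ρ (k - e _ p)| *
            |Fock.bogGamma (neg _) (halfSpace _) (tAmp v ρ) p * Fock.bogSigma (neg _) (halfSpace _) (tAmp v ρ) p|
          ≤ |W v ρ (k - e _ p)| * (4 / 3 * (ρ * W v ρ 0 * boxSide ρ ^ 2 / (8 * Real.pi ^ 2 * nsq (e _ p)))) :=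
            mul_le_mul_of_nonneg_left (h1.trans (by gcongr)) (abs_nonneg _)
        _ = _ := by field_simp; ring
    refine hsub.trans ?_
    rw [← Finset.mul_sum]
    exact mul_le_mul_of_nonneg_left (sum_abs_W_div_nsq_le hv hsupp hρ hR h2 k) (by positivity)

end LowSums

end BCSTrial

end Literature.MathematicalPhysics.QuantumManyBody.BoseGas

end
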